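import Mathlib
import HarnessLib
import Summits.HubbardSuperconductivity.HubbardSuperconductivity.Theorems.KLProgrammeKLRegimeTwoVolumeDefectTannery

/-!
# Route `KLProgramme` — crux K3, VL child `KLRegimeVolumeLimitV17F2` (stmt-HubbardSuperconductivity-20440), blueprint v5 M5 kit: LINEAR ALGEBRA OF `normV`
# (seat hubbard-kl-k3c4-p1 g12; `--supports` 20440)

The M5 composition feeds `…SrcSectorScaleSuccBundled` with profiles of the form `ε · n` (`ε = imagTimeWeight β M`, `n` an L-free budget) and rows of the form
`αW/ε`, and must (i) pull the uniform factor `ε` out of every `normV` (so that the smallness lines are ε-free and the bound is `ε ×` an ε-free linear form — the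
END door divides by `ε`), and (ii) replace L-dependent profiles by their budgets inside `normV`.  `normV Γ κ ρ N = Σ_{m′ ≤ |Γ|/2} (e²(κ+ρ))^{2m′} N(m′)` is a
finite positive linear functional of `N`; this file records exactly that:

* `normV_const_mul`, `normV_smul_fun` — `normV (c·N) = c · normV N`;
* `normV_add` — `normV (N₁ + N₂) = normV N₁ + normV N₂`;
* `normV_mono` — `N ≤ N′ ⇒ normV N ≤ normV N′` (`κ, ρ ≥ 0`);
* `normV_zero_fun` — `normV 0 = 0`.

Pure bookkeeping; no definition.
-/

noncomputable section

namespace Summit.HubbardSuperconductivity.HubbardSuperconductivity.Theorems.TwoVolumeDefect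

set_option linter.dupNamespace false -- summit = problem name (single-conjunct summit), D-0017

open Finset Literature.MathematicalPhysics.QuantumLattice

variable {Γ : Type*} [Fintype Γ]

/-- `normV (c·N) = c · normV N`. [folklore] -/
theorem normV_const_mul (κ ρ c : ℝ) (N : ℕ → ℝ) : normV Γ κ ρ (fun m => c * N m) = c * normV Γ κ ρ N := by
  unfold normV
  rw [mul_sum]
  exact sum_congr rfl fun m _ => by ring

/-- `normV (c • N) = c · normV N`. [folklore] -/
theorem normV_smul_fun (κ ρ c : ℝ) (N : ℕ → ℝ) : normV Γ κ ρ (c • N) = c * normV Γ κ ρ N := by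
  rw [show c • N = fun m => c * N m from funext fun m => by simp [Pi.smul_apply, smul_eq_mul]]
  exact normV_const_mul κ ρ c N

/-- `normV (N₁ + N₂) = normV N₁ + normV N₂`. [folklore] -/
theorem normV_add (κ ρ : ℝ) (N₁ N₂ : ℕ → ℝ) : normV Γ κ ρ (fun m => N₁ m + N₂ m) = normV Γ κ ρ N₁ + normV Γ κ ρ N₂ := by
  unfold normV
  rw [← sum_add_distrib]
  exact sum_congr rfl fun m _ => by ring

/-- `normV` is monotone in the profile (`κ, ρ ≥ 0`). [folklore] -/
theorem normV_mono {κ ρ : ℝ} (hκ : 0 ≤ κ) (hρ : 0 ≤ ρ) {N N' : ℕ → ℝ} (h : ∀ m, N m ≤ N' m) : normV Γ κ ρ N ≤ normV Γ κ ρ N' := by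
  unfold normV
  exact sum_le_sum fun m _ => mul_le_mul_of_nonneg_left (h m) (normVWeight_nonneg κ ρ hκ hρ m)

/-- `normV 0 = 0`. [folklore] -/
theorem normV_zero_fun (κ ρ : ℝ) : normV Γ κ ρ (fun _ => 0) = 0 := by
  unfold normV
  simp

/-- **The smallness lines are ε-invariant**: `(α/ε) · normV (ε·N) = α · normV N` for `ε ≠ 0`. [folklore] -/
theorem div_mul_normV_const_mul {κ ρ α ε : ℝ} (hε : ε ≠ 0) (N : ℕ → ℝ) :
    α / ε * normV Γ κ ρ (fun m => ε * N m) = α * normV Γ κ ρ N := by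
  rw [normV_const_mul]; field_simp

end Summit.HubbardSuperconductivity.HubbardSuperconductivity.Theorems.TwoVolumeDefect

end
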